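import Literature.NumberTheory.EllipticCurves.HeegnerPointsKolyvaginConjugation
import Literature.NumberTheory.GaloisCohomology.Howard2004.ConjugationDatumOfLifts
import HarnessLib

/-!
# The conjugation datum of an imaginary quadratic field: Howard's `τ` as the TRANSPORT of a complex conjugation of `Γ_ℚ`
# (existence of the inputs of `ConjugationDatum.ofLifts` with `τ = e c₀ e⁻¹`; proofs file)

Topic `NumberTheory/EllipticCurves` (D1 road of cell `pub/bsd-print-x9`; the `cd` slot of the shared μ-crux's
`stub_howardInputs` and the `hτ` input of `eisensteinDVRSetting_h5a` / `eisensteinDVRSettingTame_satisfiesH_of`).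
THEOREMS ONLY; no definition, no named fact, no instance, no notation, no `sorry`.

Howard, §1.3 [arXiv:1202.6340 p. 7, L33–48]: «`τ` complex conjugation, extended to an involution of `K̄`»; the tree's
`Howard2004.ConjugationDatum` carries `σ ∈ Aut(K)`, an involutive lift `τ` of `σ` to `K̄`, conjugation of `Γ_K`, places
and local groups (`ConjugationDatum.ofLifts σ hσ₁ hσ τ hτ hτ₂`, lit p6446xx).  For `K` imaginary quadratic and `c₀ ∈ Γ_ℚ`
a complex conjugation (`IsComplexConjugation (Rat.castHom ℝ) c₀`) the canonical choice is `σ` = the non-trivial element of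
`Aut(K/ℚ)` (order `2`) and `τ := e c₀ e⁻¹` its transport to `K̄` (`absGaloisTransport`), which lifts `σ`
(`RatClosure.isLiftOfAut_absGaloisTransport_of_isImaginaryQuadratic`) and is involutive (`c₀² = 1`, the transport is a
group isomorphism):
* `IsImaginaryQuadratic.exists_algEquiv_ne_one_mul_self` — `∃ σ ∈ Aut(K/ℚ)`, `σ ≠ 1`, `σ² = 1`;
* `involutive_absGaloisTransport_of_isComplexConjugation` — `τ = e c₀ e⁻¹` is involutive;
* **`exists_conjugationDatum_ofLifts_τ_eq_absGaloisTransport`** — the inputs `(σ, hσ₁, hσ, hτ, hτ₂)` of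
  `ConjugationDatum.ofLifts` exist with `τ = e c₀ e⁻¹`; for the resulting datum `cd`, `cd.τ x = (e c₀ e⁻¹) x` and
  `cd.σ = σ` — EXACTLY the hypothesis `hτ` of `WeierstrassCurve.eisensteinDVRSetting_h5a` and the `ofLifts` shape of
  `eisensteinDVRSetting_h5b_of` / x9-p1-w3's H.5(b) lemmas.
BSD is not proved by any of this.

References: [Howard2004HeegnerKolyvagin] §1.3 (arXiv p. 7, L33–48); [GrossLMS1991] §3 (proof of Prop. 3.6), §5.
-/

set_option autoImplicit false

noncomputable section

open Function NumberField Field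

namespace Literature.NumberTheory.EllipticCurves

open Literature.NumberTheory.GaloisRepresentations Literature.NumberTheory.GaloisCohomology.Howard2004

variable {K : Type} [Field K] [NumberField K]

/-- **`Aut(K/ℚ) = {1, σ}` with `σ² = 1`** for `K` imaginary quadratic (a Galois extension of degree `2`).
[cite: GrossLMS1991, §5 (Gal(K/ℚ) = ⟨1, τ⟩)] -/
theorem IsImaginaryQuadratic.exists_algEquiv_ne_one_mul_self (hK : IsImaginaryQuadratic K) :
    ∃ σ : K ≃ₐ[ℚ] K, σ ≠ 1 ∧ σ * σ = 1 := by
  haveI : Algebra.IsQuadraticExtension ℚ K := ⟨hK.1⟩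
  have hcard : Nat.card (K ≃ₐ[ℚ] K) = 2 := by rw [IsGalois.card_aut_eq_finrank, hK.1]
  obtain ⟨σ, hσ₁, hσ⟩ := (Nat.card_eq_two_iff' (1 : K ≃ₐ[ℚ] K)).mp hcard
  refine ⟨σ, hσ₁, ?_⟩
  by_contra h
  exact hσ₁ (by simpa [mul_eq_left] using (hσ (σ * σ) h))

/-- **The transport `e c₀ e⁻¹` of a complex conjugation `c₀ ∈ Γ_ℚ` to `K̄` is an involution** (`c₀² = 1` and the
transport `Γ_ℚ ≃* Aut(K̄/ℚ)` is multiplicative). [cite: GrossLMS1991, §3 (τ lifts to an involution)] -/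
theorem involutive_absGaloisTransport_of_isComplexConjugation {c₀ : absoluteGaloisGroup ℚ}
    (hc₀ : IsComplexConjugation (Rat.castHom ℝ) c₀) :
    Function.Involutive (absGaloisTransport (K := ℚ) (L := K) c₀).toRingEquiv := by
  intro x
  have h : absGaloisTransport (K := ℚ) (L := K) c₀ * absGaloisTransport (K := ℚ) (L := K) c₀ = 1 := by
    rw [← map_mul, ← pow_two, hc₀.sq_eq_one, map_one]
  change absGaloisTransport (K := ℚ) (L := K) c₀ (absGaloisTransport (K := ℚ) (L := K) c₀ x) = x
  rw [← AlgEquiv.mul_apply, h, AlgEquiv.one_apply]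

/-- **The inputs of `ConjugationDatum.ofLifts` for an imaginary quadratic `K` with `τ` the transport of a complex
conjugation `c₀ ∈ Γ_ℚ`**: there are `σ ∈ Aut(K/ℚ)` with `σ ≠ 1`, `σ² = 1`, lifted by the involution `τ = e c₀ e⁻¹` of `K̄`;
the resulting conjugation datum has `cd.σ = σ` and `cd.τ = e c₀ e⁻¹` pointwise — the hypothesis `hτ` of
`WeierstrassCurve.eisensteinDVRSetting_h5a` (H.5(a): `τ` is a complex conjugation on `T̄ = E[p]`).
[cite: Howard2004HeegnerKolyvagin, §1.3 (arXiv p. 7, L33–48)] [cite: GrossLMS1991, §3 (proof of Prop. 3.6)] -/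
theorem exists_conjugationDatum_ofLifts_τ_eq_absGaloisTransport (hK : IsImaginaryQuadratic K)
    {c₀ : absoluteGaloisGroup ℚ} (hc₀ : IsComplexConjugation (Rat.castHom ℝ) c₀) :
    ∃ (σ : K ≃ₐ[ℚ] K) (hσ₁ : σ ≠ 1) (hσ : σ * σ = 1)
      (hτ : IsLiftOfAut σ (absGaloisTransport (K := ℚ) (L := K) c₀).toRingEquiv)
      (hτ₂ : Function.Involutive (absGaloisTransport (K := ℚ) (L := K) c₀).toRingEquiv),
      (ConjugationDatum.ofLifts σ hσ₁ hσ _ hτ hτ₂).σ = σ ∧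
        ∀ x, (ConjugationDatum.ofLifts σ hσ₁ hσ _ hτ hτ₂).τ x = absGaloisTransport (K := ℚ) (L := K) c₀ x := by
  obtain ⟨σ, hσ₁, hσ⟩ := hK.exists_algEquiv_ne_one_mul_self
  exact ⟨σ, hσ₁, hσ, RatClosure.isLiftOfAut_absGaloisTransport_of_isImaginaryQuadratic hK hσ₁ hc₀,
    involutive_absGaloisTransport_of_isComplexConjugation hc₀, rfl, fun _ ↦ rfl⟩

end Literature.NumberTheory.EllipticCurves

end
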